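import Summits.RiemannHypothesis.RiemannHypothesis.Theorems.TiltedLandingLaw421R3KiKim
import Summits.RiemannHypothesis.RiemannHypothesis.Theorems.TiltedLandingLaw421R2Ready
import Literature.Analysis.Complex.JensenCircles

/-! # Ki–Kim (3.1) corollary — BRIDGE to the tree's tokens (W-08 C4 «kernel desk», rh-idea-6 g27; ADD-ON to `…R3KiKim`)

LANDS AFTER `Theorems/TiltedLandingLaw421R3KiKim.lean` (= C4 g27 image `kikim31-proof-W08-C4-rh-idea-6-g27.lean` d0482fc096b1c8f8,
director (CA337) PART 0): this file imports it BY MODULE NAME and adds, in the same namespace `RhW08.KiKim`: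

§B1 the two `.Finite` hypotheses of `KiKim31Corollary` are AUTOMATIC — a simple zero is isolated (`eventually_ne_zero_of_simple_zero`,
from the one-sided sign lemmas of the base file) and `[a,b]` is compact (`Set.Infinite.exists_accPt_of_subset_isCompact`), so
`finite_zeros_of_simple : {x ∈ [a,b] | g x = 0}.Finite`; hence ★`kiKim31Corollary_noFin` (same statement, finiteness discharged).

§B2 BRIDGE: for `f` with every `iteratedDeriv k f` entire (the Literature twin `Literature.Analysis.Complex.differentiable_iteratedDeriv_of_entire` (JensenCircles) discharges this for entire `f` — v2: the v1 image re-declared it and was SKIPPED by the gate lint `dedup.landed`, lead g16 06:51Z; now CITED, not restated),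
the real trace `realTrace f k x := (iteratedDeriv k f ↑x).re` is a derivative ladder on `ℝ` (`hasDerivAt_realTrace`, via
`HasDerivAt.real_of_complex` + `iteratedDeriv_succ`; `continuous_realTrace`), and the dictionary is literal:
`lawEvent_realTrace_iff : LawEvent (realTrace f) k x ↔ RhIdea6.G17.W07C7.NLEventOf f k x` (`Iff.rfl`, Seam01's token). Therefore
★★★`nlEventOf_of_surplus`: Ki–Kim's hypotheses of (3.1) at `λ = j+1` on `[a,b]` — `Re f^{(j)}`, `Re f^{(j+1)}` non-zero at `a,b`, simple zeros,
and `#zeros Re f^{(j+1)} ≥ #zeros Re f^{(j)} + 2` — give `∃ c ∈ (a,b), NLEventOf f j c`; and ★★`tiltReady_of_surplus`: if moreover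
`|a − x₀|, |b − x₀| < (j+3)R/2` then `RhW08.StSwap.TiltReady η f x₀ s hmax R Hs B j u` (R2Ready's token) — the REAL (Ki–Kim) HALF of the
EXISTENCE clause «landing ⇒ TiltReady» (director (CA335)/(CA336); C1 WORDS-62 (4)). What it does NOT give: the zero-count surplus itself
(that is the LAW's / the couple's input — C1/C3's attribution half), nor anything about `ξ`.

TREE RELATION: the analytic-with-multiplicity form of (3.1) is `Literature.Analysis.Complex.KiKim.fourK_nonneg_dvd_iff`
(`Literature/Analysis/Complex/FourierPolyaKiKimCounting.lean`); the present bridge runs on the elementary `KiKim31Corollary` (C1's typing,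
`HasDerivAt` ladders + `Set.ncard`), which needs no analyticity bookkeeping at the call site.

CHECK: this text was farm-checked as the COMPOSITE `kikim31-bridge-composite-W08-C4-rh-idea-6-g27.lean` (= base file d0482fc0 with
`import …TiltedLandingLaw421R2Ready` ++ this body): rc 0 · 0 err · 0 warn · 0 sorry · `RhW08.KiKim.tiltReady_of_surplus` axioms
{propext, Classical.choice, Quot.sound}. Standalone elaboration = after the base module exists under the name imported above (if the lead
lands the base under another module name, change line 1 only).

Nothing here bears on the truth of RH; RH is NOT proved; `stmt-RiemannHypothesis-24774` OPEN. -/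

open Set Filter Topology

namespace RhW08.KiKim

/-! ## §B1 The finiteness hypotheses of `KiKim31Corollary` are automatic -/

/-- a SIMPLE zero is isolated: `φ c = 0`, `HasDerivAt φ d c`, `d ≠ 0` ⇒ `φ ≠ 0` on a punctured neighbourhood of `c`. -/
theorem eventually_ne_zero_of_simple_zero {φ : ℝ → ℝ} {d c : ℝ} (h : HasDerivAt φ d c) (h0 : φ c = 0)
    (hd : d ≠ 0) : ∀ᶠ y in 𝓝[≠] c, φ y ≠ 0 := by
  have key : ∀ {ψ : ℝ → ℝ} {e : ℝ}, HasDerivAt ψ e c → ψ c = 0 → 0 < e → ∀ᶠ y in 𝓝[≠] c, ψ y ≠ 0 := by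
    intro ψ e hψ hψ0 he
    rw [← nhdsLT_sup_nhdsGT, Filter.eventually_sup]
    exact ⟨(eventually_neg_left_of_hasDerivAt hψ hψ0 he).mono fun y hy => hy.ne,
      (eventually_pos_right_of_hasDerivAt hψ hψ0 he).mono fun y hy => hy.ne'⟩
  rcases lt_or_gt_of_ne hd with hneg | hpos
  · have h' := key h.neg (by simp [h0]) (neg_pos.2 hneg)
    exact h'.mono fun y hy => fun hy0 => hy (by simp [hy0])
  · exact key h h0 hpos

/-- ★ simple zeros in a compact interval are finitely many: if `g` has derivative values `g'` on `[a,b]` and every zero of `g`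
there has `g' ≠ 0`, then `{x ∈ [a,b] | g x = 0}` is finite (Bolzano–Weierstrass `Set.Infinite.exists_accPt_of_subset_isCompact`
+ isolation). -/
theorem finite_zeros_of_simple {g g' : ℝ → ℝ} {a b : ℝ} (hg : ∀ x ∈ Icc a b, HasDerivAt g (g' x) x)
    (hsimp : ∀ x ∈ Icc a b, g x = 0 → g' x ≠ 0) : {x ∈ Icc a b | g x = 0}.Finite := by
  by_contra hinf
  obtain ⟨x, hxab, hacc⟩ :=
    Set.Infinite.exists_accPt_of_subset_isCompact hinf isCompact_Icc (fun y hy => hy.1)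
  rw [accPt_iff_frequently_nhdsNE] at hacc
  have hgc : ContinuousAt g x := (hg x hxab).continuousAt
  have hx0 : g x = 0 := by
    by_contra hne
    have hev : ∀ᶠ y in 𝓝[≠] x, g y ≠ 0 := (hgc.eventually_ne hne).filter_mono nhdsWithin_le_nhds
    obtain ⟨y, hyZ, hy⟩ := (hacc.and_eventually hev).exists
    exact hy hyZ.2
  have hiso := eventually_ne_zero_of_simple_zero (hg x hxab) hx0 (hsimp x hxab hx0)
  obtain ⟨y, hyZ, hy⟩ := (hacc.and_eventually hiso).exists
  exact hy hyZ.2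

/-- ★★ `KiKim31Corollary` WITHOUT the two finiteness hypotheses (they follow from simplicity of the zeros). -/
theorem kiKim31Corollary_noFin (g g' g'' : ℝ → ℝ) (a b : ℝ) (hab : a < b)
    (hg : ∀ x ∈ Icc a b, HasDerivAt g (g' x) x) (hg' : ∀ x ∈ Icc a b, HasDerivAt g' (g'' x) x) (hg''c : Continuous g'')
    (hga : g a ≠ 0) (hgb : g b ≠ 0) (hg'a : g' a ≠ 0) (hg'b : g' b ≠ 0)
    (hsimp : ∀ x ∈ Icc a b, g x = 0 → g' x ≠ 0) (hsimp' : ∀ x ∈ Icc a b, g' x = 0 → g'' x ≠ 0)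
    (hcard : {x ∈ Icc a b | g x = 0}.ncard + 2 ≤ {x ∈ Icc a b | g' x = 0}.ncard) :
    ∃ c ∈ Ioo a b, g' c = 0 ∧ 0 < g c * g'' c :=
  kiKim31Corollary g g' g'' a b hab hg hg' hg''c hga hgb hg'a hg'b hsimp hsimp'
    (finite_zeros_of_simple hg hsimp) (finite_zeros_of_simple hg' hsimp') hcard

/-! ## §B2 BRIDGE to the tree's tokens: the real trace of `f`, `NLEventOf`, `TiltReady` -/

section Bridge

open RhIdea6.G17.W07C7

/-- the real-trace ladder of `f`: `realTrace f k x = Re f^{(k)}(x)`. -/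
noncomputable def realTrace (f : ℂ → ℂ) (k : ℕ) (x : ℝ) : ℝ := (iteratedDeriv k f (x : ℂ)).re

/-- the dictionary is literal: a LAW event of the real trace IS the tree's `NLEventOf` (Seam01). -/
theorem lawEvent_realTrace_iff (f : ℂ → ℂ) (k : ℕ) (x : ℝ) : LawEvent (realTrace f) k x ↔ NLEventOf f k x :=
  Iff.rfl

/-- the real trace is a derivative ladder when every `f^{(k)}` is entire: `d/dx Re f^{(k)}(x) = Re f^{(k+1)}(x)`
(`HasDerivAt.real_of_complex`). -/
theorem hasDerivAt_realTrace {f : ℂ → ℂ} (hD : ∀ k : ℕ, Differentiable ℂ (iteratedDeriv k f)) (k : ℕ) (x : ℝ) :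
    HasDerivAt (realTrace f k) (realTrace f (k + 1) x) x := by
  have h : HasDerivAt (fun y : ℝ => (iteratedDeriv k f (y : ℂ)).re) ((deriv (iteratedDeriv k f) (x : ℂ)).re) x :=
    ((hD k) (x : ℂ)).hasDerivAt.real_of_complex
  have e1 : realTrace f k = fun y : ℝ => (iteratedDeriv k f (y : ℂ)).re := rfl
  have e2 : realTrace f (k + 1) x = (deriv (iteratedDeriv k f) (x : ℂ)).re := by
    simp only [realTrace, iteratedDeriv_succ]
  rw [e1, e2]
  exact h

/-- … hence every real trace is continuous. -/
theorem continuous_realTrace {f : ℂ → ℂ} (hD : ∀ k : ℕ, Differentiable ℂ (iteratedDeriv k f)) (k : ℕ) :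
    Continuous (realTrace f k) :=
  continuous_iff_continuousAt.2 fun x => (hasDerivAt_realTrace hD k x).continuousAt

/-- ★★★ SURPLUS ⇒ NL EVENT (the real half of the EXISTENCE clause). If every `f^{(k)}` is entire and, on `[a,b]` (`a < b`), the
real traces `Re f^{(j)}`, `Re f^{(j+1)}` are non-zero at `a` and `b`, have only simple zeros (`Re f^{(j)} = 0 ⇒ Re f^{(j+1)} ≠ 0`,
`Re f^{(j+1)} = 0 ⇒ Re f^{(j+2)} ≠ 0`), and `Re f^{(j+1)}` has at least TWO MORE zeros in `[a,b]` than `Re f^{(j)}` (Ki–Kim's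
hypotheses of (3.1) with `λ = j+1`), then the tree's `NLEventOf f j c` holds at some `c ∈ (a,b)`. -/
theorem nlEventOf_of_surplus {f : ℂ → ℂ} (hD : ∀ k : ℕ, Differentiable ℂ (iteratedDeriv k f)) (j : ℕ) {a b : ℝ}
    (hab : a < b) (hja : realTrace f j a ≠ 0) (hjb : realTrace f j b ≠ 0)
    (ha : realTrace f (j + 1) a ≠ 0) (hb : realTrace f (j + 1) b ≠ 0)
    (hsimp : ∀ x ∈ Icc a b, realTrace f j x = 0 → realTrace f (j + 1) x ≠ 0)
    (hsimp' : ∀ x ∈ Icc a b, realTrace f (j + 1) x = 0 → realTrace f (j + 2) x ≠ 0)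
    (hcount : {x ∈ Icc a b | realTrace f j x = 0}.ncard + 2 ≤ {x ∈ Icc a b | realTrace f (j + 1) x = 0}.ncard) :
    ∃ c ∈ Ioo a b, NLEventOf f j c := by
  obtain ⟨c, hc, h0, hpos⟩ := kiKim31Corollary_noFin (realTrace f j) (realTrace f (j + 1)) (realTrace f (j + 2)) a b
    hab (fun x _ => hasDerivAt_realTrace hD j x) (fun x _ => hasDerivAt_realTrace hD (j + 1) x)
    (continuous_realTrace hD (j + 2)) hja hjb ha hb hsimp hsimp' hcount
  refine ⟨c, hc, (lawEvent_realTrace_iff f j c).1 (lawEvent_of_simpleCritical ⟨h0, ?_, ?_⟩)⟩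
  · exact fun h2 => (ne_of_gt hpos) (by rw [h2, mul_zero])
  · exact hpos

/-- ★★ … and inside the LAW's range `|c − x₀| < (j+3)R/2` it is `TiltReady` at level `j` (any state `u`, any bookkeeping
parameters `η s hmax Hs B`): the real, Ki–Kim half of «landing ⇒ TiltReady». -/
theorem tiltReady_of_surplus {f : ℂ → ℂ} (hD : ∀ k : ℕ, Differentiable ℂ (iteratedDeriv k f)) {j : ℕ} {a b x₀ : ℝ}
    (η s hmax R Hs : ℝ) (B : ℕ) (u : ℂ)
    (hab : a < b) (hja : realTrace f j a ≠ 0) (hjb : realTrace f j b ≠ 0)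
    (ha : realTrace f (j + 1) a ≠ 0) (hb : realTrace f (j + 1) b ≠ 0)
    (hsimp : ∀ x ∈ Icc a b, realTrace f j x = 0 → realTrace f (j + 1) x ≠ 0)
    (hsimp' : ∀ x ∈ Icc a b, realTrace f (j + 1) x = 0 → realTrace f (j + 2) x ≠ 0)
    (hcount : {x ∈ Icc a b | realTrace f j x = 0}.ncard + 2 ≤ {x ∈ Icc a b | realTrace f (j + 1) x = 0}.ncard)
    (haw : |a - x₀| < ((j : ℝ) + 3) * R / 2) (hbw : |b - x₀| < ((j : ℝ) + 3) * R / 2) :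
    RhW08.StSwap.TiltReady η f x₀ s hmax R Hs B j u := by
  obtain ⟨c, hc, hNL⟩ := nlEventOf_of_surplus hD j hab hja hjb ha hb hsimp hsimp' hcount
  refine ⟨c, ?_, hNL⟩
  rw [abs_lt] at haw hbw ⊢
  constructor <;> linarith [hc.1, hc.2]

end Bridge

/-- sanity: for an entire `f`, `hD` is discharged and the dictionary reads `NLEventOf` off the real trace. -/
example {f : ℂ → ℂ} (hf : Differentiable ℂ f) (k : ℕ) (x : ℝ) (h : LawEvent (realTrace f) k x) :
    RhIdea6.G17.W07C7.NLEventOf f k x ∧ Differentiable ℂ (iteratedDeriv (k + 5) f) :=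
  ⟨(lawEvent_realTrace_iff f k x).1 h, Literature.Analysis.Complex.differentiable_iteratedDeriv_of_entire hf (k + 5)⟩


end RhW08.KiKim
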